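import Summits.ABC.StewartYu.ArchG3RecLinesKFa
import HarnessLib

/-!
# The archimedean record `ArchG3Rec` — letter lines in closed form, file KFb: DENOMINATORS AND ORDER COSTS OF THE (F) BUDGET LINE

Support file (theorems only; no named facts). Cell `abc-stewartyu`, route `YuMatveevShapeRat`, crux r2 `ArchCoreRat`
(stmt-ABC-20502), line `arch-g3-frame`, stub `stub_recLinesArch`, R50: the (F) conjuncts of `KStepLinesK`/`OddStepLinesK`
(p1). The atoms of one step at `(lev, ν)`, in the unit `Z`, with `κ = 2^{n−1}`:
* `cDR_le'`: for `x ≤ Nf lev (ν+1)`, `a < Tf lev μ`: `cDR lev a x ≤ (23/160)·Tf lev μ·X + 2^ν·((1+2^{-20})n/(4(n+1)) + 1/500)·Z + 2·ΣA`;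
* `Tcost_step_le`: the order-proportional costs `Tf lev μ·(WN + log N + log(κn) + 3log(n+2) + 1 + Ŝ·log 2) + (23/160)·Tf lev μ·X
  ≤ (7/100)·Z + 4·Z·(T−1)/(T+1)` for `μ ≥ 1`, `n ≥ 2` (`Tf_pos_le` + `T_absorb`).

## References
* [Nesterenko2003] Yu. V. Nesterenko, LNM 1819 (2003) — §4.2 (4.24)–(4.35).
-/

noncomputable section

open Finset Real
open scoped Nat

namespace Summit.ABC.StewartYu

namespace ArchG3Rec

open PadicG3Par (Cb Cb_pos)
open ArchG3Par (G K yloadK G_eq G_pos K_pos yloadK_pos)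

variable {n : ℕ} (P : ArchG3Rec n)

/-! ### The denominators -/

set_option maxHeartbeats 400000 in
/-- **`cDR lev a x ≤ (23/160)·Tf lev μ·X + 2^ν·((1+2^{-20})·n/(4(n+1)) + 1/500)·Z + 2·ΣA`** for `x ≤ Nf lev (ν+1)`, `a < Tf lev μ`
(`H ≤ X/8`, `Σⱼ(LνRR lev j/N)A j ≤ (1+2^{-20})nL/2^lev`, `Nf lev (ν+1) ≤ 2^{ν+1}(2^{lev}X/2 + 1)`). [folklore] -/
theorem cDR_le' (lev ν μ a : ℕ) {x : ℝ} (hx : x ≤ P.Nf lev (ν + 1)) (ha : a < P.Tf lev μ) :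
    P.cDR lev a x ≤ 23 / 160 * (P.Tf lev μ : ℝ) * P.X +
      2 ^ ν * (((1 + 1 / 2 ^ 20) * n / (4 * ((n : ℝ) + 1)) + 1 / 500) * P.Z) + 2 * P.SAR := by
  obtain ⟨hH1, hHle, -⟩ := P.H_bounds
  obtain ⟨-, hSum⟩ := P.sum_LνRR_A_le lev
  have hSum0 := (P.LνRR_A_le lev).2.2
  obtain ⟨hZ0, hZW, hZn, hXL⟩ := P.Z_floors
  obtain ⟨e, hXs1⟩ := P.Nf_real lev (ν + 1)
  have hXs := P.Xs_le_dbl lev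
  have hX := P.X_floors.2.1
  have hL := P.L_real.2.1
  have hn1 : (1 : ℝ) ≤ n := by exact_mod_cast P.hn
  have hy8 : G n * P.X / (64 * (n + 1)) = (P.X : ℝ) / 8 := by rw [G_eq]; field_simp; ring
  rw [hy8] at hHle
  have ha' : (a : ℝ) ≤ P.Tf lev μ := by exact_mod_cast ha.le
  unfold cDR
  -- first term
  have h1 : 23 / 20 * (a : ℝ) * P.H ≤ 23 / 160 * (P.Tf lev μ : ℝ) * P.X := by
    have := mul_le_mul ha' hHle (by linarith) (Nat.cast_nonneg _)
    nlinarith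
  -- second term: `2 x Σ ≤ 2·(2^{ν+1}(2^lev X/2 + 1))·(1+ε) n L/2^lev = 2^{ν+1}(1+ε) n (X L + 2L/2^lev) ≤ 2^{ν+1}(1+ε)n(XL + 2L)`
  have h2l : (0 : ℝ) < 2 ^ lev := by positivity
  have h2l1 : (1 : ℝ) ≤ 2 ^ lev := one_le_pow₀ (by norm_num)
  have h2ν : (0 : ℝ) ≤ 2 ^ (ν + 1) := by positivity
  have hx' : x ≤ 2 ^ (ν + 1) * (2 ^ lev * P.X / 2 + 1) := by
    rw [e] at hx; exact hx.trans (mul_le_mul_of_nonneg_left hXs h2ν)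
  have hfrac : (2 ^ lev * (P.X : ℝ) / 2 + 1) / 2 ^ lev ≤ P.X / 2 + 1 := by
    rw [div_le_iff₀ h2l]; nlinarith only [h2l1, hX]
  have h2 : 2 * x * ∑ j, (P.LνRR lev j : ℝ) / P.N * P.A j ≤
      2 * (2 ^ (ν + 1) * (2 ^ lev * P.X / 2 + 1)) * ((1 + 1 / 2 ^ 20) * n * P.L / 2 ^ lev) :=
    mul_le_mul (by linarith) hSum hSum0 (by positivity)
  have e2 : 2 * (2 ^ (ν + 1) * (2 ^ lev * P.X / 2 + 1)) * ((1 + 1 / 2 ^ 20) * n * (P.L : ℝ) / 2 ^ lev) =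
      2 ^ ν * (4 * (1 + 1 / 2 ^ 20) * n * P.L) * ((2 ^ lev * (P.X : ℝ) / 2 + 1) / 2 ^ lev) := by
    rw [pow_succ]; ring
  have h2' : 2 * x * ∑ j, (P.LνRR lev j : ℝ) / P.N * P.A j ≤ 2 ^ ν * (4 * (1 + 1 / 2 ^ 20) * n * P.L) * (P.X / 2 + 1) := by
    rw [e2] at h2
    exact h2.trans (mul_le_mul_of_nonneg_left hfrac (by positivity))
  have hq : 2 * (1 + 1 / 2 ^ 20) * (n : ℝ) * (P.X * P.L) = (1 + 1 / 2 ^ 20) * n / (4 * ((n : ℝ) + 1)) * P.Z := by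
    rw [hXL, G_eq]; field_simp; ring
  have hr : 4 * (1 + 1 / 2 ^ 20) * (n : ℝ) * P.L ≤ 1 / 500 * P.Z := by
    have hpoly : 2001 * (n : ℝ) ≤ 512 * ((n : ℝ) + 1) ^ 2 := by nlinarith only [hn1, sq_nonneg ((n : ℝ) - 1)]
    have := mul_le_mul_of_nonneg_right hpoly hL.le
    nlinarith only [this, hZn, hL, hn1]
  have h20 : (0 : ℝ) ≤ 2 ^ ν := by positivity
  have e3 : 2 ^ ν * (4 * (1 + 1 / 2 ^ 20) * n * (P.L : ℝ)) * (P.X / 2 + 1) =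
      2 ^ ν * (2 * (1 + 1 / 2 ^ 20) * n * (P.X * P.L) + 4 * (1 + 1 / 2 ^ 20) * n * P.L) := by ring
  have h3 : 2 ^ ν * (2 * (1 + 1 / 2 ^ 20) * n * (P.X * P.L) + 4 * (1 + 1 / 2 ^ 20) * n * (P.L : ℝ)) ≤
      2 ^ ν * (((1 + 1 / 2 ^ 20) * n / (4 * ((n : ℝ) + 1)) + 1 / 500) * P.Z) := by
    apply mul_le_mul_of_nonneg_left _ h20
    rw [hq]; linarith
  linarith

/-! ### The order-proportional costs -/

set_option maxHeartbeats 400000 in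
/-- **the `Tf`-proportional costs of a step are paid by `(7/100)·Z` and the gain surplus**: for `μ ≥ 1`, `n ≥ 2`,
`Tf lev μ·(WN + log N + log(2^{n−1}·n) + 3·log(n+2) + 1) + Tf lev μ·(Ŝ·log 2) + (23/160)·Tf lev μ·X ≤ (7/100)·Z + 4·Z·(T−1)/(T+1)`.
[folklore] -/
theorem Tcost_step_le (hn2 : 2 ≤ n) (lev μ : ℕ) (hμ : 1 ≤ μ) :
    (P.Tf lev μ : ℝ) * (P.WN + Real.log P.N + Real.log (((2 ^ (n - 1) : ℕ) : ℝ) * n) + 3 * Real.log ((n : ℝ) + 2) + 1) +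
      (P.Tf lev μ : ℝ) * (P.Sd * Real.log 2) + 23 / 160 * (P.Tf lev μ : ℝ) * P.X ≤
      7 / 100 * P.Z + 4 * P.Z * ((P.T lev - 1 : ℝ) / (P.T lev + 1)) := by
  have hT := P.Tf_pos_le hn2 lev μ hμ
  obtain ⟨hZ0, hZW, hZn, hXL⟩ := P.Z_floors
  have hSd := P.Sd_log_le.2
  have hSdL := P.Sd_real_le_L
  have hlogN := P.WN_bounds.2.2.1
  have hWN1 := P.WN_bounds.1
  have hN := P.N_facts
  have hX := P.X_floors.2.1
  have hX64 : 64 * ((n : ℝ) + 1) ≤ P.X := by exact_mod_cast P.X_floors.1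
  have h8W := P.eight_WN_le_X
  have hL := P.L_real.2.1
  have hn : (2 : ℝ) ≤ n := by exact_mod_cast hn2
  have hn0 : (0 : ℝ) < n := by linarith
  have hT0 : (0 : ℝ) ≤ P.Tf lev μ := Nat.cast_nonneg _
  have hTl0 : (0 : ℝ) ≤ P.T lev := Nat.cast_nonneg _
  -- `log(2^{n-1} n) ≤ 1.7 n`, `log(n+2) ≤ (n+2)(10/27)`
  have hl2 : Real.log 2 ≤ 0.6932 := by have := Real.log_two_lt_d9; linarith
  have hl20 : 0 ≤ Real.log 2 := Real.log_nonneg one_le_two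
  have hκ : Real.log (((2 ^ (n - 1) : ℕ) : ℝ) * n) ≤ 17 / 10 * n := by
    push_cast
    rw [Real.log_mul (by positivity) hn0.ne', Real.log_pow]
    have h2 : Real.log (n : ℝ) ≤ n - 1 := Real.log_le_sub_one_of_pos hn0
    have h3 : ((n - 1 : ℕ) : ℝ) = n - 1 := by rw [Nat.cast_sub (by omega)]; simp
    rw [h3]; nlinarith
  have hκ0 : 0 ≤ Real.log (((2 ^ (n - 1) : ℕ) : ℝ) * n) :=
    Real.log_nonneg (ArchG3Rec.kappa_pred_le Nat.one_le_two_pow P.hn).2.2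
  have hl : Real.log ((n : ℝ) + 2) ≤ ((n : ℝ) + 2) * (10 / 27) := by
    have h1 : Real.log (((n : ℝ) + 2) / Real.exp 1) ≤ ((n : ℝ) + 2) / Real.exp 1 - 1 := Real.log_le_sub_one_of_pos (by positivity)
    rw [Real.log_div (by positivity) (Real.exp_pos 1).ne', Real.log_exp] at h1
    have he : (27 / 10 : ℝ) ≤ Real.exp 1 := by have := Real.exp_one_gt_d9; linarith
    have h2 : ((n : ℝ) + 2) / Real.exp 1 ≤ ((n : ℝ) + 2) / (27 / 10) := div_le_div_of_nonneg_left (by positivity) (by norm_num) he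
    have e : ((n : ℝ) + 2) / (27 / 10) = ((n : ℝ) + 2) * (10 / 27) := by ring
    linarith
  have hl0 : 0 ≤ Real.log ((n : ℝ) + 2) := Real.log_nonneg (by linarith)
  -- the total multiplier `Λ' ≤ 3 WN + 12.82 n + 32.3 + 0.144 X ≤ (16/9) X`
  have hΛ : P.WN + Real.log P.N + Real.log (((2 ^ (n - 1) : ℕ) : ℝ) * n) + 3 * Real.log ((n : ℝ) + 2) + 1 +
      P.Sd * Real.log 2 + 23 / 160 * P.X ≤ 3 * P.WN + (1282 / 100) * n + (323 / 10) + (144 / 1000) * P.X := by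
    linarith
  have hΛ0 : 0 ≤ P.WN + Real.log P.N + Real.log (((2 ^ (n - 1) : ℕ) : ℝ) * n) + 3 * Real.log ((n : ℝ) + 2) + 1 +
      P.Sd * Real.log 2 + 23 / 160 * P.X := by
    have : (0 : ℝ) ≤ P.Sd * Real.log 2 := by positivity
    linarith [hN.2.2]
  have hΛX : 3 * P.WN + (1282 / 100) * (n : ℝ) + (323 / 10) + (144 / 1000) * P.X ≤ 16 / 9 * P.X := by
    linarith
  -- rewrite the LHS as `Tf · Λ'`
  have eL : (P.Tf lev μ : ℝ) * (P.WN + Real.log P.N + Real.log (((2 ^ (n - 1) : ℕ) : ℝ) * n) + 3 * Real.log ((n : ℝ) + 2) + 1) +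
      (P.Tf lev μ : ℝ) * (P.Sd * Real.log 2) + 23 / 160 * (P.Tf lev μ : ℝ) * P.X =
      (P.Tf lev μ : ℝ) * (P.WN + Real.log P.N + Real.log (((2 ^ (n - 1) : ℕ) : ℝ) * n) + 3 * Real.log ((n : ℝ) + 2) + 1 +
        P.Sd * Real.log 2 + 23 / 160 * P.X) := by ring
  rw [eL]
  generalize P.WN + Real.log P.N + Real.log (((2 ^ (n - 1) : ℕ) : ℝ) * n) + 3 * Real.log ((n : ℝ) + 2) + 1 +
      P.Sd * Real.log 2 + 23 / 160 * P.X = Λ at hΛ hΛ0 ⊢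
  -- `Tf Λ ≤ ((3/4)L + (n+1)(Ŝ+1)) Λ + (2n+1) T Λ`
  have h1 : (P.Tf lev μ : ℝ) * Λ ≤ (3 / 4 * P.L + ((n : ℝ) + 1) * (P.Sd + 1)) * Λ + (2 * n + 1) * P.T lev * Λ := by
    have := mul_le_mul_of_nonneg_right hT hΛ0; linarith
  -- the `T`-part
  have hΛX' : Λ ≤ 16 / 9 * P.X := hΛ.trans hΛX
  have h2 := P.T_absorb lev hΛX'
  -- the `L`-part: `(3/4 L + (n+1)(Ŝ+1)) ≤ ((n+4)/4) L` and `L·Λ'' ≤ …`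
  have hSd1 : ((n : ℝ) + 1) * (P.Sd + 1) ≤ ((n : ℝ) + 1) * P.L / 4 := by
    have : (P.Sd : ℝ) + 1 ≤ P.L / 4 := by linarith
    have hn1 : (0 : ℝ) ≤ (n : ℝ) + 1 := by linarith
    calc ((n : ℝ) + 1) * (P.Sd + 1) ≤ ((n : ℝ) + 1) * (P.L / 4) := mul_le_mul_of_nonneg_left this hn1
      _ = ((n : ℝ) + 1) * P.L / 4 := by ring
  have h3 : (3 / 4 * P.L + ((n : ℝ) + 1) * (P.Sd + 1)) * Λ ≤ (((n : ℝ) + 4) / 4 * P.L) * (3 * P.WN + (1282 / 100) * n + (323 / 10) + (144 / 1000) * P.X) := by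
    have hc : 3 / 4 * P.L + ((n : ℝ) + 1) * (P.Sd + 1) ≤ ((n : ℝ) + 4) / 4 * P.L := by linarith
    exact mul_le_mul hc hΛ hΛ0 (by positivity)
  -- `((n+4)/4) L (3 WN + 12.82 n + 32.3 + 0.144 X) ≤ 0.06 Z`
  have hXL' : (P.X : ℝ) * P.L = P.Z / (8 * ((n : ℝ) + 1)) := by rw [hXL, G_eq]
  have h4 : (((n : ℝ) + 4) / 4 * P.L) * (3 * P.WN + (1282 / 100) * n + (323 / 10) + (144 / 1000) * P.X) ≤ 6 / 100 * P.Z := by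
    have hn1 : (0 : ℝ) < (n : ℝ) + 1 := by linarith
    have hpos : (0 : ℝ) < 4 * ((n : ℝ) + 1) ^ 2 := by positivity
    have hu1 : ((n : ℝ) + 1) * P.L * P.WN ≤ P.Z / 64 := by rw [le_div_iff₀ (by norm_num)]; linarith
    have hu2 : ((n : ℝ) + 1) ^ 2 * P.L ≤ P.Z / 512 := by rw [le_div_iff₀ (by norm_num)]; linarith
    have hu3 : ((n : ℝ) + 1) * (P.X * P.L) = P.Z / 8 := by rw [hXL, G_eq]; field_simp
    have key : (((n : ℝ) + 4) / 4 * P.L) * (3 * P.WN + (1282 / 100) * n + (323 / 10) + (144 / 1000) * P.X) * (4 * ((n : ℝ) + 1) ^ 2) ≤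
        6 / 100 * P.Z * (4 * ((n : ℝ) + 1) ^ 2) := by
      have e : (((n : ℝ) + 4) / 4 * P.L) * (3 * P.WN + (1282 / 100) * n + (323 / 10) + (144 / 1000) * P.X) * (4 * ((n : ℝ) + 1) ^ 2) =
          ((n : ℝ) + 4) * (3 * ((n : ℝ) + 1) * (((n : ℝ) + 1) * P.L * P.WN) + ((1282 / 100) * n + 323 / 10) * (((n : ℝ) + 1) ^ 2 * P.L) +
            (144 / 1000) * ((n : ℝ) + 1) * (((n : ℝ) + 1) * (P.X * P.L))) := by ring
      rw [e, hu3]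
      have c1 : 0 ≤ ((n : ℝ) + 4) * (3 * ((n : ℝ) + 1)) := by positivity
      have c2 : 0 ≤ ((n : ℝ) + 4) * ((1282 / 100 : ℝ) * n + 323 / 10) := by positivity
      have a1 := mul_le_mul_of_nonneg_left hu1 c1
      have a2 := mul_le_mul_of_nonneg_left hu2 c2
      -- the polynomial inequality `(n+4)(3(n+1)/64 + c(n)/512 + 0.018(n+1)) ≤ 0.24 (n+1)^2`
      have hpoly : ((n : ℝ) + 4) * (3 * ((n : ℝ) + 1) / 64 + ((1282 / 100) * n + 323 / 10) / 512 + (144 / 1000) * ((n : ℝ) + 1) / 8) ≤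
          6 / 100 * (4 * ((n : ℝ) + 1) ^ 2) := by nlinarith only [hn, sq_nonneg ((n : ℝ) - 2)]
      have a3 := mul_le_mul_of_nonneg_right hpoly hZ0.le
      linarith only [a1, a2, a3]
    exact le_of_mul_le_mul_right key hpos
  -- `(2n+1) Λ ≤ Z/100` (debris)
  have h5 : (2 * (n : ℝ) + 1) * Λ ≤ 1 / 100 * P.Z := by
    have h6 : (2 * (n : ℝ) + 1) * Λ ≤ (2 * n + 1) * (16 / 9 * P.X) := mul_le_mul_of_nonneg_left hΛX' (by linarith)
    -- `(2n+1) X ≤ 2(n+1) X = Z/(4 L) ≤ Z / 2^28`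
    have h7 : (2 * (n : ℝ) + 1) * P.X ≤ P.Z / (4 * P.L) := by
      rw [le_div_iff₀ (by positivity)]
      have : (2 * (n : ℝ) + 1) * P.X * (4 * P.L) ≤ 8 * ((n : ℝ) + 1) * (P.X * P.L) := by
        have hXL0 : (0 : ℝ) ≤ P.X * P.L := by positivity
        nlinarith only [hXL0, hn]
      rw [hXL, G_eq] at this
      have e : 8 * ((n : ℝ) + 1) * (P.Z / (8 * ((n : ℝ) + 1))) = P.Z := by field_simp
      linarith
    have hL28 : (2 : ℝ) ^ 27 ≤ P.L := le_trans (pow_le_pow_right₀ (by norm_num) (by omega)) P.L_real.2.2.1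
    have h8 : P.Z / (4 * P.L) ≤ P.Z / 2 ^ 29 := by
      apply div_le_div_of_nonneg_left hZ0.le (by positivity)
      rw [show (2 : ℝ) ^ 29 = 4 * 2 ^ 27 by norm_num]; linarith
    linarith
  linarith

end ArchG3Rec

end Summit.ABC.StewartYu
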